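import Mathlib
import Literature.NumberTheory.LFunctions.SuzukiCanonicalSystem
import Literature.NumberTheory.LFunctions.SuzukiSingleOperatorKernelProofs
import Summits.RiemannHypothesis.RiemannHypothesis.Theorems.SuzukiHSWindow
import Summits.RiemannHypothesis.RiemannHypothesis.Theorems.SuzukiWindowsDoorHSWindow
import HarnessLib

/-!
# The Galerkin (low-rank + Hilbert–Schmidt remainder) window certificate (K-general, RH-free, ζ-free)

This is the kernel-checked LOGIC of the DBR column's certified operator-norm windows (cell rh-dbr, DATA.md
§ET1b/§ET1c: `‖𝖪_θ[t]‖ < 1` beyond the Hilbert–Schmidt radius).  Let `S = (−t,t)`, `μ = Lebesgue|S`,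
`K : ℝ → ℝ` continuous, `φ₁,…,φₙ` bounded measurable and ORTHONORMAL in `L²(S)`, `M` ANY real `n×n`
matrix, and put `D(x,y) := K(x+y) − Σᵢⱼ Mᵢⱼ φᵢ(x) φⱼ(y)` (kernel minus a finite-rank part).  If
`|cᵀ M c| ≤ μ₀ |c|²` for all `c ∈ ℝⁿ` and `∫_S∫_S D² ≤ δ²`, and `μ₀ + δ < 1`, then `±1` is not an
eigenvalue of `f ↦ ∫_S K(·+y) f(y) dy` on `L²(S)` (`NoUnitEigenvalue K t`).
Proof: for an eigenfunction, `‖f‖² = ε⟨f, 𝖪f⟩ = ε⟨f, 𝔻f⟩ + ε cᵀMc` with `cᵢ = ⟨φᵢ,f⟩`; the first term is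
`≤ δ‖f‖²` (AM–GM form of Cauchy–Schwarz, as in `SuzukiWindowsDoorHSWindow`), the second `≤ μ₀ Σcᵢ² ≤ μ₀‖f‖²`
(Bessel), so `(1 − μ₀ − δ)‖f‖² ≤ 0`.  With `M` = the Galerkin matrix `Mᵢⱼ = ⟨φᵢ ⊗ φⱼ, K⟩` one has
`∫∫D² = ∫∫K² − Σ Mᵢⱼ²` (Bessel's equality), which is how the engine evaluates `δ`; the theorem is stated for
arbitrary `M`, so that identity is not needed here.  RH-FREE; a window certified this way is an unconditional
finite fact about one explicit operator and never evidence for RH.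

References: M. Suzuki, J. Funct. Anal. 281 (2021) 109116 = arXiv:1606.05726, §3.2–§3.4 (Fredholm /
Hilbert–Schmidt control of `𝖪[t]`); M. Suzuki, ASPM 84 (2020) = arXiv:1907.07302, Thm. 1.2 (K-v).
-/

set_option linter.dupNamespace false

noncomputable section

open MeasureTheory Set

namespace Summit.RiemannHypothesis.RiemannHypothesis.Theorems.SuzukiWindowsDoorGalerkinWindow

open Summit.RiemannHypothesis.RiemannHypothesis.Theorems.SuzukiWindowsDoorHSWindow (two_mul_le_weighted_sq)

/-- **Bessel's inequality on the window**, integral form: if `φ₁,…,φₙ` are bounded measurable and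
orthonormal in `L²(μ)`, `μ = Lebesgue|(−t,t)`, and `f ∈ L²(μ)`, then `Σᵢ (∫ φᵢ f dμ)² ≤ ∫ f² dμ`.
[folklore: Bessel's inequality] -/
theorem sum_sq_integral_mul_le {t : ℝ} {n : ℕ} {φ : Fin n → ℝ → ℝ} (hφm : ∀ i, Measurable (φ i)) {B : ℝ}
    (hφb : ∀ i x, |φ i x| ≤ B)
    (horth : ∀ i j, ∫ x in Ioo (-t) t, φ i x * φ j x = if i = j then 1 else 0)
    {f : ℝ → ℝ} (hf : MemLp f 2 (volume.restrict (Ioo (-t) t))) :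
    ∑ i, (∫ x in Ioo (-t) t, φ i x * f x) ^ 2 ≤ ∫ x in Ioo (-t) t, f x ^ 2 := by
  set μ : Measure ℝ := volume.restrict (Ioo (-t) t) with hμ
  haveI : IsFiniteMeasure μ := by
    rw [hμ]; exact isFiniteMeasure_restrict.2 (by rw [Real.volume_Ioo]; exact ENNReal.ofReal_ne_top)
  have hf2 : Integrable (fun x => f x ^ 2) μ := hf.integrable_sq
  have hf1 : Integrable f μ := hf.integrable one_le_two
  have hφae : ∀ i, AEStronglyMeasurable (φ i) μ := fun i => (hφm i).aestronglyMeasurable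
  have hφbd : ∀ i, ∀ᵐ x ∂μ, ‖φ i x‖ ≤ B := fun i =>
    Filter.Eventually.of_forall fun x => by rw [Real.norm_eq_abs]; exact hφb i x
  have hφ1 : ∀ i, Integrable (φ i) μ := fun i =>
    (MemLp.of_bound (hφae i) B (hφbd i) : MemLp (φ i) 1 μ).integrable le_rfl
  have hφf : ∀ i, Integrable (fun x => φ i x * f x) μ := fun i => hf1.bdd_mul (hφae i) (hφbd i)
  have hφφ : ∀ i j, Integrable (fun x => φ i x * φ j x) μ := fun i j => (hφ1 j).bdd_mul (hφae i) (hφbd i)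
  set c : Fin n → ℝ := fun i => ∫ x, φ i x * f x ∂μ with hc
  -- the projection g = Σ cᵢ φᵢ
  set g : ℝ → ℝ := fun x => ∑ i, c i * φ i x with hg
  have hgm : AEStronglyMeasurable g μ := by
    refine Finset.aestronglyMeasurable_fun_sum _ fun i _ => ?_
    exact (hφae i).const_mul (c i)
  have hgb : ∀ᵐ x ∂μ, ‖g x‖ ≤ ∑ i, |c i| * B := by
    refine Filter.Eventually.of_forall fun x => ?_
    calc ‖g x‖ = |∑ i, c i * φ i x| := Real.norm_eq_abs _
      _ ≤ ∑ i, |c i * φ i x| := Finset.abs_sum_le_sum_abs _ _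
      _ ≤ ∑ i, |c i| * B := Finset.sum_le_sum fun i _ => by
          rw [abs_mul]; exact mul_le_mul_of_nonneg_left (hφb i x) (abs_nonneg _)
  have hgf : Integrable (fun x => g x * f x) μ := hf1.bdd_mul hgm hgb
  have hg1 : Integrable g μ := (MemLp.of_bound hgm _ hgb : MemLp g 1 μ).integrable le_rfl
  have hgg : Integrable (fun x => g x * g x) μ := hg1.bdd_mul hgm hgb
  -- ∫ g f = Σ cᵢ²
  have hint_gf : ∫ x, g x * f x ∂μ = ∑ i, c i ^ 2 := by
    have : (fun x => g x * f x) = fun x => ∑ i, c i * (φ i x * f x) := by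
      funext x; simp only [hg, Finset.sum_mul]; refine Finset.sum_congr rfl fun i _ => by ring
    rw [this, integral_finsetSum _ fun i _ => (hφf i).const_mul (c i)]
    refine Finset.sum_congr rfl fun i _ => ?_
    rw [integral_const_mul, sq]
  -- ∫ g g = Σ cᵢ²
  have hint_gg : ∫ x, g x * g x ∂μ = ∑ i, c i ^ 2 := by
    have : (fun x => g x * g x) = fun x => ∑ i, ∑ j, c i * c j * (φ i x * φ j x) := by
      funext x; simp only [hg, Finset.sum_mul_sum]
      refine Finset.sum_congr rfl fun i _ => Finset.sum_congr rfl fun j _ => by ring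
    rw [this, integral_finsetSum _ fun i _ => ?_]
    · refine Finset.sum_congr rfl fun i _ => ?_
      rw [integral_finsetSum _ fun j _ => (hφφ i j).const_mul _]
      have : ∀ j, ∫ x, c i * c j * (φ i x * φ j x) ∂μ = c i * c j * (if i = j then 1 else 0) := by
        intro j; rw [integral_const_mul, ← horth i j]
      simp_rw [this]
      simp [Finset.sum_ite_eq, sq]
    · exact integrable_finsetSum _ fun j _ => (hφφ i j).const_mul _
  -- 0 ≤ ∫ (f - g)² = A - 2 Σc² + Σc²
  have hsq : ∀ x, (f x - g x) ^ 2 = f x ^ 2 - 2 * (g x * f x) + g x * g x := fun x => by ring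
  have hpos : 0 ≤ ∫ x, (f x - g x) ^ 2 ∂μ := integral_nonneg fun x => sq_nonneg _
  have hcalc : ∫ x, (f x - g x) ^ 2 ∂μ = (∫ x, f x ^ 2 ∂μ) - 2 * ∑ i, c i ^ 2 + ∑ i, c i ^ 2 := by
    simp_rw [hsq]
    rw [integral_add, integral_sub, integral_const_mul, hint_gf, hint_gg]
    all_goals first
      | exact hf2
      | exact hgg
      | exact hgf.const_mul 2
      | exact hf2.sub (hgf.const_mul 2)
  linarith

/-- **Galerkin window certificate** (RH-free, `ζ`-free, K-general; the logic of the rh-dbr ET1b/ET1c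
certificates).  `S = (−t,t)`, `K` continuous, `φ₁,…,φₙ` bounded measurable and orthonormal in `L²(S)`,
`M` any real matrix with `|cᵀMc| ≤ μ₀ Σcᵢ²`, and the finite-rank remainder
`D(x,y) = K(x+y) − Σᵢⱼ Mᵢⱼ φᵢ(x)φⱼ(y)` with `∫_S∫_S D² ≤ δ²`.  If `μ₀ + δ < 1` then
`NoUnitEigenvalue K t` (`±1 ∉ spec` of `f ↦ ∫_S K(·+y)f(y)dy` on `L²(S)`).
[cite: Suzuki2021Hamiltonians, §3.4 (Hilbert–Schmidt / Fredholm control of 𝖪[t]); folklore: Bessel] -/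
theorem noUnitEigenvalue_of_galerkin_certificate {K : ℝ → ℝ} (hK : Continuous K) {t : ℝ} {n : ℕ}
    {φ : Fin n → ℝ → ℝ} (hφm : ∀ i, Measurable (φ i)) {B : ℝ} (hφb : ∀ i x, |φ i x| ≤ B)
    (horth : ∀ i j, ∫ x in Ioo (-t) t, φ i x * φ j x = if i = j then 1 else 0)
    (M : Matrix (Fin n) (Fin n) ℝ) {μ₀ δ : ℝ} (hμ₀ : 0 ≤ μ₀) (hδ : 0 < δ)
    (hM : ∀ c : Fin n → ℝ, |∑ i, ∑ j, c i * M i j * c j| ≤ μ₀ * ∑ i, c i ^ 2)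
    (hD : ∫ x in Ioo (-t) t, ∫ y in Ioo (-t) t,
      (K (x + y) - ∑ i, ∑ j, M i j * φ i x * φ j y) ^ 2 ≤ δ ^ 2)
    (hΛ : μ₀ + δ < 1) :
    Literature.NumberTheory.LFunctions.NoUnitEigenvalue K t := by
  intro ε hε f hf heig
  set μ : Measure ℝ := volume.restrict (Ioo (-t) t) with hμ
  have hε2 : ε ^ 2 = 1 := by rcases hε with rfl | rfl <;> norm_num
  have hεabs : |ε| = 1 := by rcases hε with rfl | rfl <;> norm_num
  haveI : IsFiniteMeasure μ := by
    rw [hμ]; exact isFiniteMeasure_restrict.2 (by rw [Real.volume_Ioo]; exact ENNReal.ofReal_ne_top)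
  -- the remainder kernel
  set D : ℝ → ℝ → ℝ := fun x y => K (x + y) - ∑ i, ∑ j, M i j * φ i x * φ j y with hDdef
  -- basic integrability facts
  have hf2 : Integrable (fun x => f x ^ 2) μ := hf.integrable_sq
  have hf1 : Integrable f μ := hf.integrable one_le_two
  set A : ℝ := ∫ x, f x ^ 2 ∂μ with hA
  have hA0 : 0 ≤ A := integral_nonneg fun x => sq_nonneg _
  have hφae : ∀ i, AEStronglyMeasurable (φ i) μ := fun i => (hφm i).aestronglyMeasurable
  have hφbd : ∀ i, ∀ᵐ x ∂μ, ‖φ i x‖ ≤ B := fun i =>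
    Filter.Eventually.of_forall fun x => by rw [Real.norm_eq_abs]; exact hφb i x
  have hφ1 : ∀ i, Integrable (φ i) μ := fun i =>
    (MemLp.of_bound (hφae i) B (hφbd i) : MemLp (φ i) 1 μ).integrable le_rfl
  have hφf : ∀ i, Integrable (fun y => φ i y * f y) μ := fun i => hf1.bdd_mul (hφae i) (hφbd i)
  set c : Fin n → ℝ := fun i => ∫ y, φ i y * f y ∂μ with hc
  -- Bessel: Σ cᵢ² ≤ A
  have hBessel : ∑ i, c i ^ 2 ≤ A := sum_sq_integral_mul_le hφm hφb horth hf
  -- kernel rows are in L²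
  have hKL2 : ∀ x, MemLp (fun y => K (x + y)) 2 μ := fun x => SuzukiHSWindow.memLp_two_kernel_row hK t x
  have hKf : ∀ x, Integrable (fun y => K (x + y) * f y) μ := fun x => (hKL2 x).integrable_mul hf
  -- the finite-rank rows are bounded measurable
  have hφB : ∀ i x, |φ i x| ≤ |B| := fun i x => (hφb i x).trans (le_abs_self B)
  set CR : ℝ := ∑ i, ∑ j, |M i j| * |B| * |B| with hCR
  have hRm : ∀ x, AEStronglyMeasurable (fun y => ∑ i, ∑ j, M i j * φ i x * φ j y) μ := by
    intro x
    refine Finset.aestronglyMeasurable_fun_sum _ fun i _ => Finset.aestronglyMeasurable_fun_sum _ fun j _ => ?_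
    exact (hφae j).const_mul (M i j * φ i x)
  have hRabs : ∀ x y, |∑ i, ∑ j, M i j * φ i x * φ j y| ≤ CR := by
    intro x y
    calc |∑ i, ∑ j, M i j * φ i x * φ j y| ≤ ∑ i, |∑ j, M i j * φ i x * φ j y| :=
          Finset.abs_sum_le_sum_abs _ _
      _ ≤ ∑ i, ∑ j, |M i j * φ i x * φ j y| :=
          Finset.sum_le_sum fun i _ => Finset.abs_sum_le_sum_abs _ _
      _ ≤ ∑ i, ∑ j, |M i j| * |B| * |B| := by
          refine Finset.sum_le_sum fun i _ => Finset.sum_le_sum fun j _ => ?_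
          rw [abs_mul, abs_mul]
          exact mul_le_mul (mul_le_mul_of_nonneg_left (hφB i x) (abs_nonneg _)) (hφB j y)
            (abs_nonneg _) (mul_nonneg (abs_nonneg _) (abs_nonneg _))
  have hRb : ∀ x, ∀ᵐ y ∂μ, ‖∑ i, ∑ j, M i j * φ i x * φ j y‖ ≤ CR := fun x =>
    Filter.Eventually.of_forall fun y => by rw [Real.norm_eq_abs]; exact hRabs x y
  have hRf : ∀ x, Integrable (fun y => (∑ i, ∑ j, M i j * φ i x * φ j y) * f y) μ := fun x =>
    hf1.bdd_mul (hRm x) (hRb x)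
  have hDf : ∀ x, Integrable (fun y => D x y * f y) μ := by
    intro x
    refine ((hKf x).sub (hRf x)).congr (Filter.Eventually.of_forall fun y => ?_)
    simp only [hDdef, Pi.sub_apply]
    ring
  have hD2 : ∀ x, Integrable (fun y => D x y ^ 2) μ := by
    intro x
    have h : MemLp (fun y => D x y) 2 μ := (hKL2 x).sub (MemLp.of_bound (hRm x) CR (hRb x) : MemLp _ 2 μ)
    exact h.integrable_sq
  -- a uniform bound for D on the square, hence x ↦ ∫ D(x,y)² dy is integrable on the window
  obtain ⟨CK, hCK⟩ := (isCompact_Icc : IsCompact (Icc (-(2 * |t|)) (2 * |t|))).exists_bound_of_continuousOn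
    hK.continuousOn
  have hDbd : ∀ x ∈ Ioo (-t) t, ∀ y ∈ Ioo (-t) t, ‖D x y ^ 2‖ ≤ (CK + CR) ^ 2 := by
    intro x hx y hy
    have hKb : ‖K (x + y)‖ ≤ CK := hCK (x + y) ⟨by nlinarith [hx.1, hy.1, le_abs_self t, neg_abs_le t],
      by nlinarith [hx.2, hy.2, le_abs_self t]⟩
    rw [Real.norm_eq_abs] at hKb
    have hDb : |D x y| ≤ CK + CR := by
      calc |D x y| = |K (x + y) - ∑ i, ∑ j, M i j * φ i x * φ j y| := rfl
        _ ≤ |K (x + y)| + |∑ i, ∑ j, M i j * φ i x * φ j y| := abs_sub _ _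
        _ ≤ CK + CR := add_le_add hKb (hRabs x y)
    rw [Real.norm_eq_abs, abs_pow, ← sq_abs (CK + CR)]
    exact pow_le_pow_left₀ (abs_nonneg _) (hDb.trans (le_abs_self _)) 2
  have hDx : Integrable (fun x => ∫ y, D x y ^ 2 ∂μ) μ := by
    have hDm2 : Measurable fun p : ℝ × ℝ => D p.1 p.2 ^ 2 := by
      have hR2 : Measurable fun p : ℝ × ℝ => ∑ i, ∑ j, M i j * φ i p.1 * φ j p.2 :=
        Finset.measurable_fun_sum _ fun i _ => Finset.measurable_fun_sum _ fun j _ =>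
          (measurable_const.mul ((hφm i).comp measurable_fst)).mul ((hφm j).comp measurable_snd)
      exact ((hK.measurable.comp (measurable_fst.add measurable_snd)).sub hR2).pow_const 2
    have hsm : StronglyMeasurable (Function.uncurry fun x y : ℝ => D x y ^ 2) := hDm2.stronglyMeasurable
    have hmeas : StronglyMeasurable fun x : ℝ => ∫ y in Ioo (-t) t, D x y ^ 2 := hsm.integral_prod_right
    refine Integrable.mono' (integrable_const ((CK + CR) ^ 2 * volume.real (Ioo (-t) t)))
      hmeas.aestronglyMeasurable ?_
    filter_upwards [ae_restrict_mem measurableSet_Ioo] with x hx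
    exact norm_setIntegral_le_of_norm_le_const (μ := volume) (s := Ioo (-t) t)
      (by rw [Real.volume_Ioo]; exact ENNReal.ofReal_lt_top) (fun y hy => hDbd x hx y hy)
  have hDD : ∫ x, ∫ y, D x y ^ 2 ∂μ ∂μ ≤ δ ^ 2 := hD
  have hDD0 : 0 ≤ ∫ x, ∫ y, D x y ^ 2 ∂μ ∂μ := integral_nonneg fun x => integral_nonneg fun y => sq_nonneg _
  -- the pointwise eigen-identity  f x² = ε f x ∫ K(x+y) f y dy  (a.e. x)
  have hpt : ∀ᵐ x ∂μ, f x ^ 2 = ε * f x * ∫ y, K (x + y) * f y ∂μ := by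
    filter_upwards [heig] with x hx
    rw [hx]
    calc f x ^ 2 = ε ^ 2 * f x ^ 2 := by rw [hε2, one_mul]
      _ = ε * f x * (ε * f x) := by ring
  -- splitting the row integral into the remainder part and the finite-rank part
  have hsplit : ∀ x, ∫ y, K (x + y) * f y ∂μ = (∫ y, D x y * f y ∂μ) + ∑ i, ∑ j, M i j * φ i x * c j := by
    intro x
    have h1 : (fun y => K (x + y) * f y) =
        fun y => D x y * f y + (∑ i, ∑ j, M i j * φ i x * φ j y) * f y := by
      funext y; simp only [hDdef]; ring
    rw [h1, integral_add (hDf x) (hRf x)]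
    congr 1
    have h2 : (fun y => (∑ i, ∑ j, M i j * φ i x * φ j y) * f y) =
        fun y => ∑ i, ∑ j, M i j * φ i x * (φ j y * f y) := by
      funext y; simp only [Finset.sum_mul]
      exact Finset.sum_congr rfl fun i _ => Finset.sum_congr rfl fun j _ => by ring
    rw [h2, integral_finsetSum _ fun i _ => ?_]
    · refine Finset.sum_congr rfl fun i _ => ?_
      rw [integral_finsetSum _ fun j _ => (hφf j).const_mul _]
      exact Finset.sum_congr rfl fun j _ => by rw [integral_const_mul]
    · exact integrable_finsetSum _ fun j _ => (hφf j).const_mul _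
  -- the finite-rank term integrates to ε cᵀ M c, bounded by μ₀ A
  have hLf : Integrable (fun x => ε * f x * ∑ i, ∑ j, M i j * φ i x * c j) μ := by
    have : Integrable (fun x => ∑ i, ∑ j, (ε * M i j * c j) * (φ i x * f x)) μ :=
      integrable_finsetSum _ fun i _ => integrable_finsetSum _ fun j _ => (hφf i).const_mul _
    refine this.congr (Filter.Eventually.of_forall fun x => ?_)
    simp only [Finset.mul_sum]
    exact Finset.sum_congr rfl fun i _ => Finset.sum_congr rfl fun j _ => by ring
  have hLint : ∫ x, ε * f x * ∑ i, ∑ j, M i j * φ i x * c j ∂μ = ε * ∑ i, ∑ j, c i * M i j * c j := by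
    have h1 : (fun x => ε * f x * ∑ i, ∑ j, M i j * φ i x * c j) =
        fun x => ∑ i, ∑ j, (ε * M i j * c j) * (φ i x * f x) := by
      funext x; simp only [Finset.mul_sum]
      exact Finset.sum_congr rfl fun i _ => Finset.sum_congr rfl fun j _ => by ring
    rw [h1, integral_finsetSum _ fun i _ => ?_]
    · rw [Finset.mul_sum]
      refine Finset.sum_congr rfl fun i _ => ?_
      rw [integral_finsetSum _ fun j _ => (hφf i).const_mul _, Finset.mul_sum]
      refine Finset.sum_congr rfl fun j _ => ?_
      rw [integral_const_mul]
      show ε * M i j * c j * c i = ε * (c i * M i j * c j)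
      ring
    · exact integrable_finsetSum _ fun j _ => (hφf i).const_mul _
  have hLbound : ε * ∑ i, ∑ j, c i * M i j * c j ≤ μ₀ * A := by
    calc ε * ∑ i, ∑ j, c i * M i j * c j ≤ |ε * ∑ i, ∑ j, c i * M i j * c j| := le_abs_self _
      _ = |∑ i, ∑ j, c i * M i j * c j| := by rw [abs_mul, hεabs, one_mul]
      _ ≤ μ₀ * ∑ i, c i ^ 2 := hM c
      _ ≤ μ₀ * A := mul_le_mul_of_nonneg_left hBessel hμ₀
  -- the key inequality: for every λ > 0,  A ≤ (λ/2) δ² + A²/(2λ) + μ₀ A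
  have key : ∀ lam : ℝ, 0 < lam → A ≤ lam / 2 * δ ^ 2 + A * A / (2 * lam) + μ₀ * A := by
    intro lam hlam
    have hinner : ∀ᵐ x ∂μ, f x ^ 2 ≤ (lam / 2 * ∫ y, D x y ^ 2 ∂μ + f x ^ 2 * A / (2 * lam)) +
        ε * f x * ∑ i, ∑ j, M i j * φ i x * c j := by
      filter_upwards [hpt] with x hx
      have h1 : Integrable (fun y => D x y ^ 2) μ := hD2 x
      have hrhs_int : Integrable (fun y => (lam * D x y ^ 2 + (f x * f y) ^ 2 / lam) / 2) μ := by
        have : Integrable (fun y => lam * D x y ^ 2 + (f x) ^ 2 / lam * f y ^ 2) μ :=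
          (h1.const_mul lam).add (hf2.const_mul _)
        refine (this.div_const 2).congr (Filter.Eventually.of_forall fun y => ?_)
        simp only
        ring
      have hmono : ∫ y, ε * f x * (D x y * f y) ∂μ ≤
          ∫ y, (lam * D x y ^ 2 + (f x * f y) ^ 2 / lam) / 2 ∂μ := by
        refine integral_mono_ae ((hDf x).const_mul _) hrhs_int (Filter.Eventually.of_forall fun y => ?_)
        have hb := two_mul_le_weighted_sq (D x y) (f x * f y) lam hlam
        have hb' := two_mul_le_weighted_sq (-(D x y)) (f x * f y) lam hlam
        have habs : ε * f x * (D x y * f y) ≤ |D x y * (f x * f y)| := by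
          calc ε * f x * (D x y * f y) = ε * (D x y * (f x * f y)) := by ring
            _ ≤ |ε * (D x y * (f x * f y))| := le_abs_self _
            _ = |D x y * (f x * f y)| := by rw [abs_mul, hεabs, one_mul]
        have habs2 : |D x y * (f x * f y)| ≤ (lam * D x y ^ 2 + (f x * f y) ^ 2 / lam) / 2 := by
          rw [abs_le]
          constructor
          · nlinarith [hb', sq_nonneg (D x y)]
          · nlinarith [hb]
        exact habs.trans habs2
      have heq : ∫ y, (lam * D x y ^ 2 + (f x * f y) ^ 2 / lam) / 2 ∂μ =
          lam / 2 * ∫ y, D x y ^ 2 ∂μ + f x ^ 2 * A / (2 * lam) := by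
        calc ∫ y, (lam * D x y ^ 2 + (f x * f y) ^ 2 / lam) / 2 ∂μ
            = ∫ y, (lam / 2 * D x y ^ 2 + f x ^ 2 / (2 * lam) * f y ^ 2) ∂μ := by
              refine integral_congr_ae (Filter.Eventually.of_forall fun y => ?_); simp only; ring
          _ = lam / 2 * ∫ y, D x y ^ 2 ∂μ + f x ^ 2 / (2 * lam) * ∫ y, f y ^ 2 ∂μ := by
              rw [integral_add (h1.const_mul _) (hf2.const_mul _), integral_const_mul, integral_const_mul]
          _ = lam / 2 * ∫ y, D x y ^ 2 ∂μ + f x ^ 2 * A / (2 * lam) := by rw [← hA]; ring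
      have hfirst : ε * f x * ∫ y, D x y * f y ∂μ ≤ lam / 2 * ∫ y, D x y ^ 2 ∂μ + f x ^ 2 * A / (2 * lam) := by
        rw [← integral_const_mul]
        exact hmono.trans (le_of_eq heq)
      calc f x ^ 2 = ε * f x * ((∫ y, D x y * f y ∂μ) + ∑ i, ∑ j, M i j * φ i x * c j) := by
            rw [hx, hsplit x]
        _ = ε * f x * ∫ y, D x y * f y ∂μ + ε * f x * ∑ i, ∑ j, M i j * φ i x * c j := by ring
        _ ≤ _ := add_le_add hfirst le_rfl
    -- integrate over x
    have hrhs : Integrable (fun x => (lam / 2 * ∫ y, D x y ^ 2 ∂μ + f x ^ 2 * A / (2 * lam)) +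
        ε * f x * ∑ i, ∑ j, M i j * φ i x * c j) μ := by
      have : Integrable (fun x => lam / 2 * ∫ y, D x y ^ 2 ∂μ + A / (2 * lam) * f x ^ 2) μ :=
        (hDx.const_mul _).add (hf2.const_mul _)
      refine (this.add hLf).congr (Filter.Eventually.of_forall fun x => ?_)
      simp only [Pi.add_apply]
      ring
    have hI := integral_mono_ae hf2 hrhs hinner
    rw [← hA] at hI
    have hIeq : ∫ x, ((lam / 2 * ∫ y, D x y ^ 2 ∂μ + f x ^ 2 * A / (2 * lam)) +
        ε * f x * ∑ i, ∑ j, M i j * φ i x * c j) ∂μ =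
        lam / 2 * (∫ x, ∫ y, D x y ^ 2 ∂μ ∂μ) + A * A / (2 * lam) + ε * ∑ i, ∑ j, c i * M i j * c j := by
      have hI1 : Integrable (fun x => lam / 2 * ∫ y, D x y ^ 2 ∂μ + f x ^ 2 * A / (2 * lam)) μ := by
        have : Integrable (fun x => lam / 2 * ∫ y, D x y ^ 2 ∂μ + A / (2 * lam) * f x ^ 2) μ :=
          (hDx.const_mul _).add (hf2.const_mul _)
        refine this.congr (Filter.Eventually.of_forall fun x => ?_); simp only; ring
      rw [integral_add hI1 hLf, hLint]
      congr 1
      calc ∫ x, (lam / 2 * ∫ y, D x y ^ 2 ∂μ + f x ^ 2 * A / (2 * lam)) ∂μ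
          = ∫ x, (lam / 2 * ∫ y, D x y ^ 2 ∂μ + A / (2 * lam) * f x ^ 2) ∂μ := by
            refine integral_congr_ae (Filter.Eventually.of_forall fun x => ?_); simp only; ring
        _ = lam / 2 * (∫ x, ∫ y, D x y ^ 2 ∂μ ∂μ) + A / (2 * lam) * A := by
            rw [integral_add (hDx.const_mul _) (hf2.const_mul _), integral_const_mul, integral_const_mul, ← hA]
        _ = lam / 2 * (∫ x, ∫ y, D x y ^ 2 ∂μ ∂μ) + A * A / (2 * lam) := by ring
    rw [hIeq] at hI
    have hlam2 : 0 ≤ lam / 2 := by positivity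
    nlinarith [hI, hLbound, mul_le_mul_of_nonneg_left hDD hlam2]
  -- conclude A = 0
  have hAz : A = 0 := by
    by_contra hne
    have hApos : 0 < A := lt_of_le_of_ne hA0 (Ne.symm hne)
    have hk := key (A / δ) (div_pos hApos hδ)
    have h1 : A / δ / 2 * δ ^ 2 = A * δ / 2 := by field_simp
    have h2 : A * A / (2 * (A / δ)) = A * δ / 2 := by field_simp
    rw [h1, h2] at hk
    nlinarith [hk, hΛ, hApos]
  -- f = 0 a.e.
  have hsq : (fun x => f x ^ 2) =ᵐ[μ] 0 := by
    have := (integral_eq_zero_iff_of_nonneg_ae (Filter.Eventually.of_forall fun x => sq_nonneg (f x)) hf2).1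
    rw [← hA] at this
    exact this hAz
  filter_upwards [hsq] with x hx
  simpa using hx

/-- **Instance shape for Suzuki's single operator** (RH-free): for `θ > 1` the kernel `K_θ = limKernel θ` is
continuous ([Su20] Thm. 1.2 (K-ii), tree theorem `Suzuki2020_thm12_continuous`), so a Galerkin certificate
(orthonormal bounded measurable `φᵢ` on `(−t,t)`, any matrix `M` with `|cᵀMc| ≤ μ₀|c|²`, finite-rank remainder of
`L²((−t,t)²)`-norm `≤ δ`, and `μ₀ + δ < 1`) gives `NoUnitEigenvalue (limKernel θ) t`.  This is the kernel-checked
form of the cell rh-dbr's certified op-norm windows (DATA.md §ET1b/§ET1c, e.g. θ = 12, t ≤ 1.4 and θ = 20,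
t ≤ 1.5, where the premises are certified by interval arithmetic in two lineages); such an instance is an
unconditional finite fact, never evidence for RH. [cite: Suzuki2020IntegralOperators, Thm. 1.2 (K-v)] -/
theorem noUnitEigenvalue_limKernel_of_galerkin_certificate {θ t : ℝ} (hθ : 1 < θ) {n : ℕ}
    {φ : Fin n → ℝ → ℝ} (hφm : ∀ i, Measurable (φ i)) {B : ℝ} (hφb : ∀ i x, |φ i x| ≤ B)
    (horth : ∀ i j, ∫ x in Ioo (-t) t, φ i x * φ j x = if i = j then 1 else 0)
    (M : Matrix (Fin n) (Fin n) ℝ) {μ₀ δ : ℝ} (hμ₀ : 0 ≤ μ₀) (hδ : 0 < δ)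
    (hM : ∀ c : Fin n → ℝ, |∑ i, ∑ j, c i * M i j * c j| ≤ μ₀ * ∑ i, c i ^ 2)
    (hD : ∫ x in Ioo (-t) t, ∫ y in Ioo (-t) t,
      (Literature.NumberTheory.LFunctions.limKernel θ (x + y) - ∑ i, ∑ j, M i j * φ i x * φ j y) ^ 2 ≤ δ ^ 2)
    (hΛ : μ₀ + δ < 1) :
    Literature.NumberTheory.LFunctions.NoUnitEigenvalue (Literature.NumberTheory.LFunctions.limKernel θ) t :=
  noUnitEigenvalue_of_galerkin_certificate
    (Literature.NumberTheory.LFunctions.Suzuki2020_thm12_continuous hθ) hφm hφb horth M hμ₀ hδ hM hD hΛ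

end Summit.RiemannHypothesis.RiemannHypothesis.Theorems.SuzukiWindowsDoorGalerkinWindow

end
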